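import Summits.Ventures.HodgeRepro.CMRank

/-!
# The right action on CM types: induced types, stabilisers, primitivity

Blind re-derivation cell `pub-hodge-repro`, seat `typer` (gen 2).  Continues `CMType.lean` /
`HodgeSets.lean` / `CMRank.lean`.

In the finite-group model (`G = Gal(K/ℚ)`, `Hom(K, ℂ) ≅ G` via `g ↦ ι ∘ g`) there are TWO actions of `G`
on sets of embeddings:

* post-composition with automorphisms of `ℂ` — LEFT multiplication `g • Φ` (the Galois conjugates of the
  CM type, used in Pohlmann's criterion and in the rank; `CMType.lean`);
* pre-composition with automorphisms of `K` — RIGHT multiplication `Φ * h = {φ h : φ ∈ Φ}`, written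
  `rmul Φ h` here.  `(K, Φ)` and `(K, Φ ∘ h)` are the same CM type up to the automorphism `h` of `K`, so
  every invariant of the CM type (Pohlmann sets, Hodge counts, rank) is invariant under `rmul`.

A CM type `Φ` is *induced* (lifted) from the subfield `K^H` fixed by a subgroup `H ≤ G` iff `Φ * h = Φ`
for all `h ∈ H`; `Φ` is *primitive* iff it is not induced from a proper subfield, i.e. iff its right
stabiliser `rstab Φ = {h : Φ * h = Φ}` is trivial.  In the model this is the DEFINITION of primitivity.
Printed source (locator relayed by seat `lit`, 2026-08-22T01:34:25Z): Shimura, *Abelian varieties with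
complex multiplication and modular functions* (1998), §8.2 p. 81: "We call a CM-type primitive if the
abelian varieties of that type are simple", and Prop. 26 (p. 81): `(K, Φ)` primitive iff
`H = {γ : Φγ = Φ}` is trivial — Shimura's right-action convention is the `rmul` side here.  The
equivalence with simplicity of the abelian variety is NOT used in this file.
-/

open Finset
open scoped Pointwise

namespace HodgeRepro

variable {G : Type*} [Group G]

/-- Right translate `Φ * h = {φ * h : φ ∈ Φ}` of a set of embeddings (pre-composition with the
automorphism `h` of `K`). -/
def rmul (Φ : Finset G) (h : G) : Finset G := Φ.map (Equiv.mulRight h).toEmbedding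

/-- Membership in a right translate: `x ∈ Φ h ↔ x h⁻¹ ∈ Φ`. -/
@[simp] theorem mem_rmul {Φ : Finset G} {h x : G} : x ∈ rmul Φ h ↔ x * h⁻¹ ∈ Φ := by
  rw [rmul, Finset.mem_map_equiv, Equiv.mulRight_symm, Equiv.coe_mulRight]

/-- `x ∈ Φ ⇒ x h ∈ Φ h`. -/
theorem mul_mem_rmul {Φ : Finset G} {h x : G} (hx : x ∈ Φ) : x * h ∈ rmul Φ h := by
  rw [mem_rmul, mul_inv_cancel_right]; exact hx

/-- Right translation preserves cardinality. -/
@[simp] theorem card_rmul (Φ : Finset G) (h : G) : (rmul Φ h).card = Φ.card := Finset.card_map _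

/-- Right translation by `1`. -/
@[simp] theorem rmul_one (Φ : Finset G) : rmul Φ 1 = Φ := by
  ext x; simp

/-- Right translations compose: `(Φ h) k = Φ (h k)`. -/
theorem rmul_rmul (Φ : Finset G) (h k : G) : rmul (rmul Φ h) k = rmul Φ (h * k) := by
  ext x; simp [mul_assoc]

/-- `(Φ h) h⁻¹ = Φ`. -/
theorem rmul_inv_rmul (Φ : Finset G) (h : G) : rmul (rmul Φ h) h⁻¹ = Φ := by
  rw [rmul_rmul, mul_inv_cancel, rmul_one]

/-- Right translation is injective on subsets. -/
theorem rmul_injective (h : G) : Function.Injective (fun Φ : Finset G => rmul Φ h) := by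
  intro Φ Ψ e
  have := congrArg (fun S => rmul S h⁻¹) e
  simpa only [rmul_inv_rmul] using this

/-- Right translation commutes with intersections. -/
theorem rmul_inter [DecidableEq G] (Φ Ψ : Finset G) (h : G) : rmul (Φ ∩ Ψ) h = rmul Φ h ∩ rmul Ψ h := by
  ext x; simp

/-- Right translation commutes with complements. -/
theorem rmul_compl [DecidableEq G] [Fintype G] (Φ : Finset G) (h : G) : rmul Φᶜ h = (rmul Φ h)ᶜ := by
  ext x; simp

/-- The left (Galois) and right (automorphism) actions commute. -/
theorem smul_rmul [DecidableEq G] (g : G) (Φ : Finset G) (h : G) : g • rmul Φ h = rmul (g • Φ) h := by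
  ext x
  rw [← inv_smul_mem_iff, mem_rmul, mem_rmul, ← inv_smul_mem_iff, smul_eq_mul, smul_eq_mul, mul_assoc]

/-- Right translates of a CM type are CM types (the same type read through the automorphism `h`). -/
theorem IsCMType.rmul {c : G} {Φ : Finset G} (hΦ : IsCMType c Φ) (h : G) : IsCMType c (rmul Φ h) := by
  intro x
  rw [mem_rmul, mem_rmul, mul_assoc]
  exact hΦ (x * h⁻¹)

/-- Pohlmann's condition for the right translate `Φ h`: `Δ` is a Hodge set for `Φ h` iff `Δ h⁻¹` is one
for `Φ`. -/
theorem isHodgeSet_rmul_iff [DecidableEq G] (c : G) (Φ Δ : Finset G) (h : G) :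
    IsHodgeSet c Φ (rmul Δ h) ↔ IsHodgeSet c (rmul Φ h⁻¹) Δ := by
  rw [isHodgeSet_iff_forall_inter_eq, isHodgeSet_iff_forall_inter_eq]
  refine forall_congr' fun g => ?_
  have key : ∀ S : Finset G, (rmul Δ h ∩ g • S).card = (Δ ∩ g • rmul S h⁻¹).card := by
    intro S
    rw [← card_rmul (Δ ∩ g • rmul S h⁻¹) h, rmul_inter, ← smul_rmul, rmul_rmul, inv_mul_cancel, rmul_one]
  rw [key, key, ← smul_rmul]

/-- Pohlmann's condition is invariant under the right action on the CM type: `Δ` is a Hodge set for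
`Φ h` iff `Δ h⁻¹` is a Hodge set for `Φ`. -/
theorem isHodgeSet_rmul_type_iff [DecidableEq G] (c : G) (Φ Δ : Finset G) (h : G) :
    IsHodgeSet c (rmul Φ h) Δ ↔ IsHodgeSet c Φ (rmul Δ h⁻¹) := by
  rw [isHodgeSet_rmul_iff, inv_inv]

section Counts

variable [DecidableEq G] [Fintype G]

/-- The Hodge counts are invariant under the right action on the CM type. -/
theorem hodgeCount_rmul (c : G) (Φ : Finset G) (h : G) (p : ℕ) :
    hodgeCount c (rmul Φ h) p = hodgeCount c Φ p := by
  unfold hodgeCount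
  refine Finset.card_bij (fun Δ _ => rmul Δ h⁻¹) ?_ ?_ ?_
  · intro Δ hΔ
    simp only [mem_filter, mem_univ, true_and] at hΔ ⊢
    exact ⟨by rw [card_rmul, hΔ.1], (isHodgeSet_rmul_type_iff c Φ Δ h).1 hΔ.2⟩
  · intro Δ₁ _ Δ₂ _ e
    exact rmul_injective h⁻¹ e
  · intro Δ hΔ
    refine ⟨rmul Δ h, ?_, rmul_inv_rmul Δ h⟩
    simp only [mem_filter, mem_univ, true_and] at hΔ ⊢
    refine ⟨by rw [card_rmul, hΔ.1], ?_⟩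
    rw [isHodgeSet_rmul_type_iff, rmul_inv_rmul]
    exact hΔ.2

omit [Fintype G] in
/-- The type matrix of `Φ h` is the type matrix of `Φ` with the columns permuted by `x ↦ x h⁻¹`. -/
theorem typeMatrix_rmul (Φ : Finset G) (h : G) :
    typeMatrix (rmul Φ h) = (typeMatrix Φ).submatrix (Equiv.refl G) (Equiv.mulRight h⁻¹) := by
  ext g x
  simp only [typeMatrix_apply, Matrix.submatrix_apply, Equiv.refl_apply, Equiv.coe_mulRight,
    smul_rmul, mem_rmul]

/-- The rank of a CM type is invariant under the right action. -/
theorem cmRank_rmul (Φ : Finset G) (h : G) : cmRank (rmul Φ h) = cmRank Φ := by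
  unfold cmRank
  rw [typeMatrix_rmul, Matrix.rank_submatrix]

end Counts

/-! ### Induced types, stabilisers and primitivity -/

/-- The right stabiliser of `Φ`: the automorphisms `h` of `K` with `Φ h = Φ`.  `Φ` is induced from the
fixed field `K^H` of a subgroup `H` iff `H ≤ rstab Φ`. -/
def rstab (Φ : Finset G) : Subgroup G where
  carrier := {h | rmul Φ h = Φ}
  one_mem' := by simp
  mul_mem' := by
    intro h k hh hk
    simp only [Set.mem_setOf_eq] at hh hk ⊢
    rw [← rmul_rmul, hh, hk]
  inv_mem' := by
    intro h hh
    simp only [Set.mem_setOf_eq] at hh ⊢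
    conv_lhs => rw [← hh]
    rw [rmul_inv_rmul]

/-- Membership in the right stabiliser. -/
@[simp] theorem mem_rstab {Φ : Finset G} {h : G} : h ∈ rstab Φ ↔ rmul Φ h = Φ := Iff.rfl

/-- Membership in the right stabiliser is decidable. -/
instance (Φ : Finset G) [DecidableEq G] : DecidablePred (· ∈ rstab Φ) :=
  fun _ => decidable_of_iff _ mem_rstab.symm

/-- `Φ` is *induced from* the subgroup `H` (i.e. lifted from the subfield `K^H`) iff `Φ h = Φ` for all
`h ∈ H`. -/
def IsInducedFrom (Φ : Finset G) (H : Subgroup G) : Prop := H ≤ rstab Φ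

/-- A CM type is *primitive* iff its right stabiliser is trivial (it is not induced from any proper
subfield). -/
def IsPrimitive (Φ : Finset G) : Prop := ∀ h : G, rmul Φ h = Φ → h = 1

/-- Primitivity is decidable on a finite group. -/
instance (Φ : Finset G) [DecidableEq G] [Fintype G] : Decidable (IsPrimitive Φ) := by
  unfold IsPrimitive; infer_instance

/-- `Φ` is primitive iff its right stabiliser is trivial. -/
theorem isPrimitive_iff_rstab_eq_bot (Φ : Finset G) : IsPrimitive Φ ↔ rstab Φ = ⊥ := by
  rw [eq_bot_iff]
  constructor
  · intro hΦ h hh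
    exact Subgroup.mem_bot.2 (hΦ h hh)
  · intro hΦ h hh
    exact Subgroup.mem_bot.1 (hΦ hh)

/-- Galois conjugates of a primitive type are primitive (the two actions commute). -/
theorem IsPrimitive.smul [DecidableEq G] {Φ : Finset G} (hΦ : IsPrimitive Φ) (g : G) : IsPrimitive (g • Φ) := by
  intro h hh
  apply hΦ h
  rw [← smul_rmul] at hh
  have := congrArg (fun S => g⁻¹ • S) hh
  simpa only [inv_smul_smul] using this

/-- Right translates of a primitive type are primitive (the stabiliser is conjugated). -/
theorem IsPrimitive.rmul {Φ : Finset G} (hΦ : IsPrimitive Φ) (k : G) : IsPrimitive (rmul Φ k) := by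
  intro h hh
  rw [rmul_rmul] at hh
  have h1 : HodgeRepro.rmul Φ (k * h * k⁻¹) = Φ := by
    rw [← rmul_rmul, hh, rmul_inv_rmul]
  have h2 := hΦ _ h1
  -- `k h k⁻¹ = 1 ⇒ h = 1`
  have : h = k⁻¹ * (k * h * k⁻¹) * k := by group
  rw [this, h2]; group

/-- A CM type whose right stabiliser contains a non-trivial element `h` is induced from the subgroup
generated by `h` (the subfield `K^⟨h⟩`, of index `ord h`). -/
theorem isInducedFrom_zpowers_of_mem {Φ : Finset G} {h : G} (hh : h ∈ rstab Φ) :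
    IsInducedFrom Φ (Subgroup.zpowers h) := by
  intro x hx
  obtain ⟨n, rfl⟩ := Subgroup.mem_zpowers_iff.1 hx
  exact Subgroup.zpow_mem _ hh n

/-- The stabiliser of a CM type under a central involution cannot contain the conjugation `c` itself
(`Φ c = c Φ = Φ̄ ≠ Φ`). -/
theorem conj_not_mem_rstab [DecidableEq G] [Fintype G] {c : G} {Φ : Finset G} (hc : IsComplexConj c) (hΦ : IsCMType c Φ) :
    c ∉ rstab Φ := by
  intro h
  rw [mem_rstab] at h
  have h1 : rmul Φ c = c • Φ := by
    ext x
    rw [mem_rmul, hc.mem_smul_iff, hc.inv_eq, hc.comm]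
  rw [h1, hΦ.smul_eq_compl hc] at h
  have h2 := hΦ.ne_empty
  have h3 := congrArg (fun S => Φ ∩ S) h
  simp only [inter_compl, inter_self] at h3
  exact h2 h3.symm

end HodgeRepro
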